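import Summits.AtomisticToContinuum.BoseEinsteinCondensation.Cruxes.NudgeRemoval.StrategistCensus

/-!
# Strategist census r1 (redirect strategist, second opinion) — crux `NudgeRemoval`
(stmt-AtomisticToContinuum-14361), route `BECNudgeWalk`

Kernel-checked addendum to `STRATEGY-CENSUS.md` (r1), building on the s1 file
`Cruxes/NudgeRemoval/StrategistCensus.lean` (@ c12eaced0202: `NudgeRemoval ⟺ FlatModeCondensation`).
What this file adds, all sorry-free:

* `rewardInf` — the rewarded infimum `R_{N,L}(t) = inf_Ψ [E(Ψ) + t·(N − n₀(Ψ))]` of the crux, with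
  `rewardInf_mono` (monotone in `t`, since `N − n₀ ≥ 0`) and `rewardInf_zero` (`R(0) = E₀`).
* `nudgeRemoval_iff_bareRemoval` — the HYPOTHESIS of the crux (`R(s₀) ≤ E₀ + s₀τN` at `s₀ = θρa`) is the
  proved rung `NudgedCondensation_of`, so the crux is literally its own conclusion with the hypothesis
  deleted (`BareRemoval`): the nudge hypothesis carries no leverage.
* `dyadic_rungs`, `highWindow_holds` — for every `τ > 0` and `0 < θ' ≤ θ` the removal bound
  `R(s) ≤ E₀ + 2τsN` on the HIGH window `s ∈ [θ'ρa, θρa]` is a THEOREM (finitely many proved rungs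
  `θ/2^j` plus monotonicity of `R`). Hence every `s`-window split of the crux has a free high piece and a
  low piece `(0, θ'ρa]` that is the crux re-instantiated.
* `nudgeRemoval_iff_germRemoval` — stronger: the crux is equivalent to its own GERM at `s → 0⁺` with an
  `N`-DEPENDENT width `s₁(N) > 0` (`GermRemoval`), via `GermRemoval → FlatModeCondensation` (adapting s1's
  argument) and s1's `nudgeRemoval_of_flatModeCondensation`. So no window, not even one measured in units
  of the finite-size gap, separates a piece strictly weaker than the crux.
* `summit_of_crux` — with the proved items plugged into the route's `closes`, the crux implies the
  sub-problem `BoseEinsteinCondensation` modulo exactly the three classical finite-`N` items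
  `GroundStateRigidity`, `WalkToBEC`, `FreeDirichletBEC`; together with s1's
  `flatModeCondensation_of_nudgeRemoval` (conclusion: flat-mode fraction `≥ 1 − τ` for EVERY `τ`, i.e.
  COMPLETE condensation, dilute thermodynamic limit) this is the summit-strength certificate used in the
  r1 verdict.
-/

noncomputable section

open MeasureTheory Filter
open scoped ENNReal NNReal

namespace Summit.AtomisticToContinuum.BoseEinsteinCondensation.Cruxes.NudgeRemoval.StrategistR1

open Literature.MathematicalPhysics.QuantumManyBody.BoseGas
open Summit.AtomisticToContinuum.BoseEinsteinCondensation.Theses.BECNudgeWalk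
open Summit.AtomisticToContinuum.BoseEinsteinCondensation.Cruxes.NudgeRemoval.Birth
open Summit.AtomisticToContinuum.BoseEinsteinCondensation.Cruxes.NudgeRemoval.Strategist
open Summit.AtomisticToContinuum.BoseEinsteinCondensation.NudgedCondensationLine (NudgedCondensation_of)

/-! ## The rewarded infimum -/

/-- `R_{N,L}(t) = inf_Ψ [E(Ψ) + t (N − n₀(Ψ))]`, the nudged (rewarded) infimum of the crux. -/
def rewardInf (v : ℝ → ℝ≥0∞) (N : ℕ) (L : ℝ) (t : ℝ) : ℝ≥0∞ :=
  ⨅ Ψ : TrialState N L, (energy v Ψ + ENNReal.ofReal t * ((N : ℝ≥0∞) - occupation N (constantMode L) Ψ.ψ))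

/-- `R` is monotone in the reward (the depletion `N − n₀` is `≥ 0` in `ℝ≥0∞`). -/
theorem rewardInf_mono (v : ℝ → ℝ≥0∞) (N : ℕ) (L : ℝ) {s s' : ℝ} (h : s ≤ s') :
    rewardInf v N L s ≤ rewardInf v N L s' :=
  iInf_mono fun _ => by gcongr

/-- `R(0) = E₀`. -/
theorem rewardInf_zero (v : ℝ → ℝ≥0∞) (N : ℕ) (L : ℝ) :
    rewardInf v N L 0 = groundStateEnergy v N L := by
  simp [rewardInf, groundStateEnergy]

/-! ## The hypothesis of the crux is a theorem: `NudgeRemoval ⟺ BareRemoval` -/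

/-- The crux with its hypothesis `R(s₀) ≤ E₀ + s₀τN` DELETED. -/
def BareRemoval : Prop :=
  ∀ v : ℝ → ℝ≥0∞, IsRepulsiveFiniteRange v → ∀ τ : ℝ, 0 < τ →
    ∃ θ ρ₀ : ℝ, 0 < θ ∧ θ ≤ 1 ∧ 0 < ρ₀ ∧ ∀ ρ : ℝ, 0 < ρ → ρ < ρ₀ → ∀ᶠ N : ℕ in atTop,
      ∀ s : ℝ, 0 < s → s ≤ θ * ρ * (scatteringLength v).toReal →
        rewardInf v N (sideLength ρ N) s ≤
          groundStateEnergy v N (sideLength ρ N) + ENNReal.ofReal (2 * τ * s * N)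

/-- `NudgeRemoval → BareRemoval`: discharge the hypothesis with the proved rung. -/
theorem bareRemoval_of_nudgeRemoval (h : NudgeRemoval) : BareRemoval := by
  intro v hv τ hτ
  obtain ⟨θ, ρ₁, hθ, hθ1, hρ₁, Hrem⟩ := h v hv τ hτ
  obtain ⟨ρ₂, hρ₂, Hrung⟩ := NudgedCondensation_of v hv τ θ hτ hθ
  refine ⟨θ, min ρ₁ ρ₂, hθ, hθ1, lt_min hρ₁ hρ₂, fun ρ hρ hρlt => ?_⟩
  filter_upwards [Hrem ρ hρ (lt_of_lt_of_le hρlt (min_le_left _ _)),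
    Hrung ρ hρ (lt_of_lt_of_le hρlt (min_le_right _ _))] with N hrem hrung
  intro s hs hss
  exact hrem hrung s hs hss

/-- `BareRemoval → NudgeRemoval`: ignore the hypothesis. -/
theorem nudgeRemoval_of_bareRemoval (h : BareRemoval) : NudgeRemoval := by
  intro v hv τ hτ
  obtain ⟨θ, ρ₀, hθ, hθ1, hρ₀, H⟩ := h v hv τ hτ
  refine ⟨θ, ρ₀, hθ, hθ1, hρ₀, fun ρ hρ hρlt => ?_⟩
  filter_upwards [H ρ hρ hρlt] with N hN
  intro L s₀ R _ s hs hss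
  exact hN s hs hss

theorem nudgeRemoval_iff_bareRemoval : NudgeRemoval ↔ BareRemoval :=
  ⟨bareRemoval_of_nudgeRemoval, nudgeRemoval_of_bareRemoval⟩

/-! ## The high window is free: dyadic rungs + monotonicity -/

/-- Finitely many proved rungs at once: for every depth `J`, eventually in `N`, the rung bound holds at
every dyadic reward `θρa/2^j`, `j ≤ J`. -/
theorem dyadic_rungs (v : ℝ → ℝ≥0∞) (hv : IsRepulsiveFiniteRange v) (τ θ : ℝ) (hτ : 0 < τ)
    (hθ : 0 < θ) :
    ∀ J : ℕ, ∃ ρ₀ : ℝ, 0 < ρ₀ ∧ ∀ ρ : ℝ, 0 < ρ → ρ < ρ₀ → ∀ᶠ N : ℕ in atTop, ∀ j : ℕ, j ≤ J →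
      rewardInf v N (sideLength ρ N) (θ / 2 ^ j * ρ * (scatteringLength v).toReal) ≤
        groundStateEnergy v N (sideLength ρ N) +
          ENNReal.ofReal (θ / 2 ^ j * ρ * (scatteringLength v).toReal * τ * N) := by
  intro J
  induction J with
  | zero =>
    obtain ⟨ρ₀, hρ₀, H⟩ := NudgedCondensation_of v hv τ (θ / 2 ^ 0) hτ (by positivity)
    refine ⟨ρ₀, hρ₀, fun ρ hρ hρlt => ?_⟩
    filter_upwards [H ρ hρ hρlt] with N hN
    intro j hj
    obtain rfl : j = 0 := Nat.le_zero.1 hj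
    exact hN
  | succ J ih =>
    obtain ⟨ρ₁, hρ₁, H1⟩ := ih
    obtain ⟨ρ₂, hρ₂, H2⟩ := NudgedCondensation_of v hv τ (θ / 2 ^ (J + 1)) hτ (by positivity)
    refine ⟨min ρ₁ ρ₂, lt_min hρ₁ hρ₂, fun ρ hρ hρlt => ?_⟩
    filter_upwards [H1 ρ hρ (lt_of_lt_of_le hρlt (min_le_left _ _)),
      H2 ρ hρ (lt_of_lt_of_le hρlt (min_le_right _ _))] with N hN1 hN2
    intro j hj
    rcases Nat.of_le_succ hj with hj' | rfl
    · exact hN1 j hj'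
    · exact hN2

/-- The removal bound on a window bounded AWAY from `s = 0`, with NO hypothesis. -/
def HighWindowRemoval : Prop :=
  ∀ v : ℝ → ℝ≥0∞, IsRepulsiveFiniteRange v → ∀ τ θ θ' : ℝ, 0 < τ → 0 < θ' → θ' ≤ θ →
    ∃ ρ₀ : ℝ, 0 < ρ₀ ∧ ∀ ρ : ℝ, 0 < ρ → ρ < ρ₀ → ∀ᶠ N : ℕ in atTop,
      ∀ s : ℝ, θ' * ρ * (scatteringLength v).toReal ≤ s → s ≤ θ * ρ * (scatteringLength v).toReal →
        rewardInf v N (sideLength ρ N) s ≤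
          groundStateEnergy v N (sideLength ρ N) + ENNReal.ofReal (2 * τ * s * N)

/-- **The high window is a theorem** (proved rungs on the dyadic grid `θρa/2^j`, `θ/2^J ≤ θ'`, and
monotonicity of `R`: for `s ∈ [θρa/2^{j+1}, θρa/2^j]`, `R(s) ≤ R(θρa/2^j) ≤ E₀ + τ(θρa/2^j)N ≤ E₀ + 2τsN`). -/
theorem highWindow_holds : HighWindowRemoval := by
  intro v hv τ θ θ' hτ hθ' hθ'θ
  have hθ : 0 < θ := hθ'.trans_le hθ'θ
  -- dyadic depth `J` with `θ / 2^J ≤ θ'`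
  obtain ⟨J, hJ⟩ : ∃ J : ℕ, θ / 2 ^ J ≤ θ' := by
    obtain ⟨J, hJ⟩ := pow_unbounded_of_one_lt (θ / θ') (one_lt_two : (1 : ℝ) < 2)
    have h2J : (0 : ℝ) < 2 ^ J := by positivity
    refine ⟨J, ?_⟩
    rw [div_le_iff₀ h2J]
    have h' : θ < 2 ^ J * θ' := (div_lt_iff₀ hθ').1 hJ
    nlinarith [h']
  obtain ⟨ρ₀, hρ₀, H⟩ := dyadic_rungs v hv τ θ hτ hθ J
  refine ⟨ρ₀, hρ₀, fun ρ hρ hρlt => ?_⟩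
  filter_upwards [H ρ hρ hρlt] with N hN
  set a : ℝ := (scatteringLength v).toReal with ha
  have ha0 : 0 ≤ a := ENNReal.toReal_nonneg
  have hNr : (0 : ℝ) ≤ N := N.cast_nonneg
  -- the bound on `[θρa/2^j, θρa]`, by induction on the depth `j ≤ J`
  have key : ∀ j : ℕ, j ≤ J → ∀ s : ℝ, θ / 2 ^ j * ρ * a ≤ s → s ≤ θ * ρ * a →
      rewardInf v N (sideLength ρ N) s ≤
        groundStateEnergy v N (sideLength ρ N) + ENNReal.ofReal (2 * τ * s * N) := by
    intro j
    induction j with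
    | zero =>
      intro _ s hs1 hs2
      have e0 : θ / 2 ^ 0 * ρ * a = θ * ρ * a := by simp
      rw [e0] at hs1
      calc rewardInf v N (sideLength ρ N) s
          ≤ rewardInf v N (sideLength ρ N) (θ / 2 ^ 0 * ρ * a) :=
            rewardInf_mono v N _ (by rw [e0]; exact hs2)
        _ ≤ groundStateEnergy v N (sideLength ρ N) +
              ENNReal.ofReal (θ / 2 ^ 0 * ρ * a * τ * N) := hN 0 (Nat.zero_le _)
        _ ≤ groundStateEnergy v N (sideLength ρ N) + ENNReal.ofReal (2 * τ * s * N) := by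
            refine add_le_add le_rfl (ENNReal.ofReal_le_ofReal ?_)
            rw [e0]
            have hx0 : 0 ≤ θ * ρ * a := by positivity
            have hs0 : 0 ≤ s := hx0.trans hs1
            have h1 : θ * ρ * a * (τ * N) ≤ s * (τ * N) :=
              mul_le_mul_of_nonneg_right hs1 (by positivity)
            have h2 : 0 ≤ s * (τ * N) := by positivity
            linarith [h1, h2]
    | succ j ihj =>
      intro hj s hs1 hs2
      by_cases hsj : θ / 2 ^ j * ρ * a ≤ s
      · exact ihj (Nat.le_of_succ_le hj) s hsj hs2
      · rw [not_le] at hsj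
        have hgrid : θ / 2 ^ j * ρ * a = 2 * (θ / 2 ^ (j + 1) * ρ * a) := by
          rw [pow_succ, ← div_div]; ring
        have h2s : θ / 2 ^ j * ρ * a ≤ 2 * s := by rw [hgrid]; linarith
        have hs0 : 0 ≤ s := hs1.trans' (by positivity)
        calc rewardInf v N (sideLength ρ N) s
            ≤ rewardInf v N (sideLength ρ N) (θ / 2 ^ j * ρ * a) := rewardInf_mono v N _ hsj.le
          _ ≤ groundStateEnergy v N (sideLength ρ N) +
                ENNReal.ofReal (θ / 2 ^ j * ρ * a * τ * N) := hN j (Nat.le_of_succ_le hj)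
          _ ≤ groundStateEnergy v N (sideLength ρ N) + ENNReal.ofReal (2 * τ * s * N) := by
              refine add_le_add le_rfl (ENNReal.ofReal_le_ofReal ?_)
              have h1 : θ / 2 ^ j * ρ * a * (τ * N) ≤ 2 * s * (τ * N) :=
                mul_le_mul_of_nonneg_right h2s (by positivity)
              linarith [h1]
  intro s hs1 hs2
  refine key J le_rfl s (le_trans ?_ hs1) hs2
  have : θ / 2 ^ J * ρ * a ≤ θ' * ρ * a := by gcongr
  exact this

/-! ## The crux is its own germ at `s → 0⁺`: `NudgeRemoval ⟺ GermRemoval` -/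

/-- The removal bound on SOME right-neighbourhood of `s = 0`, of `N`-dependent width (guard `a ≠ 0`:
at `a = 0` the crux is vacuous while the flat mode is genuinely depleted in the free Dirichlet gas). -/
def GermRemoval : Prop :=
  ∀ v : ℝ → ℝ≥0∞, IsRepulsiveFiniteRange v → scatteringLength v ≠ 0 → ∀ τ : ℝ, 0 < τ →
    ∃ ρ₀ : ℝ, 0 < ρ₀ ∧ ∀ ρ : ℝ, 0 < ρ → ρ < ρ₀ → ∀ᶠ N : ℕ in atTop,
      ∃ s₁ : ℝ, 0 < s₁ ∧ ∀ s : ℝ, 0 < s → s ≤ s₁ →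
        rewardInf v N (sideLength ρ N) s ≤
          groundStateEnergy v N (sideLength ρ N) + ENNReal.ofReal (2 * τ * s * N)

/-- `NudgeRemoval → GermRemoval` (width `s₁ = θρa > 0`, via `BareRemoval`). -/
theorem germRemoval_of_nudgeRemoval (h : NudgeRemoval) : GermRemoval := by
  intro v hv ha0 τ hτ
  obtain ⟨θ, ρ₀, hθ, -, hρ₀, H⟩ := bareRemoval_of_nudgeRemoval h v hv τ hτ
  have ha : 0 < (scatteringLength v).toReal :=
    ENNReal.toReal_pos ha0 (ScatteringLengthFinite_holds v hv)
  refine ⟨ρ₀, hρ₀, fun ρ hρ hρlt => ?_⟩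
  filter_upwards [H ρ hρ hρlt] with N hN
  exact ⟨θ * ρ * (scatteringLength v).toReal, by positivity, hN⟩

/-- `GermRemoval → FlatModeCondensation`: from `R(s) ≤ E₀ + 2(τ/3)sN` at ONE small enough reward
`s ≤ s₁(N)` a near-minimiser of `F_s` is a `δ`-near-minimiser of the energy with flat-mode depletion
`≤ τN` (s1's argument for `flatModeCondensation_of_nudgeRemoval`, which used its window only near `0⁺`). -/
theorem flatModeCondensation_of_germRemoval (h : GermRemoval) : FlatModeCondensation := by
  intro v hv ha0 τ hτ
  have hτ₁ : (0 : ℝ) < τ / 3 := by positivity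
  obtain ⟨ρ₁, hρ₁, Hgerm⟩ := h v hv ha0 (τ / 3) hτ₁
  obtain ⟨ρ₃, hρ₃, Hfin⟩ := GroundStateEnergyFinite_holds v hv
  refine ⟨min ρ₁ ρ₃, by positivity, fun ρ hρ hρlt => ?_⟩
  have h1 : ρ < ρ₁ := lt_of_lt_of_le hρlt (min_le_left _ _)
  have h3 : ρ < ρ₃ := lt_of_lt_of_le hρlt (min_le_right _ _)
  filter_upwards [Hgerm ρ hρ h1, Hfin ρ hρ h3, eventually_gt_atTop 0] with N hgerm hfin hNpos
  intro δ hδ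
  set L : ℝ := sideLength ρ N with hL
  set E₀ := groundStateEnergy v N L with hE₀
  obtain ⟨s₁, hs₁, Hall⟩ := hgerm
  have Hall' : ∀ s : ℝ, 0 < s → s ≤ s₁ →
      (⨅ Ψ : TrialState N L, (energy v Ψ +
        ENNReal.ofReal s * ((N : ℝ≥0∞) - occupation N (constantMode L) Ψ.ψ))) ≤
        E₀ + ENNReal.ofReal (2 * (τ / 3) * s * N) := Hall
  have hNr : (0 : ℝ) < N := Nat.cast_pos.2 hNpos
  -- a finite slack `δ₁ ≤ δ`
  set δ₁ : ℝ≥0∞ := min δ 1 with hδ₁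
  have hδ₁pos : 0 < δ₁ := lt_min hδ one_pos
  have hδ₁top : δ₁ ≠ ⊤ := ne_top_of_le_ne_top ENNReal.one_ne_top (min_le_right _ _)
  have hδ₁le : δ₁ ≤ δ := min_le_left _ _
  set d : ℝ := δ₁.toReal with hd
  have hdpos : 0 < d := ENNReal.toReal_pos hδ₁pos.ne' hδ₁top
  -- the reward `s ≤ s₁` with `τ s N ≤ d`
  set s : ℝ := min s₁ (d / (τ * N)) with hsdef
  have hspos : 0 < s := lt_min hs₁ (by positivity)
  have hss₁ : s ≤ s₁ := min_le_left _ _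
  have hsN : τ * s * N ≤ d := by
    have : s ≤ d / (τ * N) := min_le_right _ _
    calc τ * s * N ≤ τ * (d / (τ * N)) * N := by gcongr
      _ = d := by field_simp
  have hR := Hall' s hspos hss₁
  have hRne : (⨅ Ψ : TrialState N L, (energy v Ψ +
      ENNReal.ofReal s * ((N : ℝ≥0∞) - occupation N (constantMode L) Ψ.ψ))) ≠ ⊤ :=
    ne_top_of_le_ne_top (ENNReal.add_ne_top.2 ⟨hfin, ENNReal.ofReal_ne_top⟩) hR
  have hslack : 0 < ENNReal.ofReal (τ / 3 * s * N) := ENNReal.ofReal_pos.2 (by positivity)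
  obtain ⟨Ψ, hΨ⟩ := exists_le_iInf_add _ hRne hslack
  set n₀ := occupation N (constantMode L) Ψ.ψ with hn₀
  have hsum : ENNReal.ofReal (2 * (τ / 3) * s * N) + ENNReal.ofReal (τ / 3 * s * N) =
      ENNReal.ofReal (τ * s * N) := by
    rw [← ENNReal.ofReal_add (by positivity) (by positivity)]; congr 1; ring
  have hF : energy v Ψ + ENNReal.ofReal s * ((N : ℝ≥0∞) - n₀) ≤ E₀ + ENNReal.ofReal (τ * s * N) := by
    calc energy v Ψ + ENNReal.ofReal s * ((N : ℝ≥0∞) - n₀)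
        ≤ _ := hΨ
      _ ≤ (E₀ + ENNReal.ofReal (2 * (τ / 3) * s * N)) + ENNReal.ofReal (τ / 3 * s * N) := by
          gcongr
      _ = E₀ + ENNReal.ofReal (τ * s * N) := by rw [add_assoc, hsum]
  refine ⟨Ψ, ?_, ?_⟩
  · -- energy slack
    calc energy v Ψ ≤ energy v Ψ + ENNReal.ofReal s * ((N : ℝ≥0∞) - n₀) := le_self_add
      _ ≤ E₀ + ENNReal.ofReal (τ * s * N) := hF
      _ ≤ E₀ + δ₁ := by
          gcongr
          calc ENNReal.ofReal (τ * s * N) ≤ ENNReal.ofReal d := ENNReal.ofReal_le_ofReal hsN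
            _ = δ₁ := ENNReal.ofReal_toReal hδ₁top
      _ ≤ E₀ + δ := by gcongr
  · -- flat-mode level
    have h2 : E₀ ≤ energy v Ψ := groundStateEnergy_le_energy v Ψ
    have h3 : E₀ + ENNReal.ofReal s * ((N : ℝ≥0∞) - n₀) ≤ E₀ + ENNReal.ofReal (τ * s * N) :=
      le_trans (by gcongr) hF
    have h4 : ENNReal.ofReal s * ((N : ℝ≥0∞) - n₀) ≤ ENNReal.ofReal (τ * s * N) :=
      (ENNReal.add_le_add_iff_left hfin).1 h3
    have h5 : ENNReal.ofReal (τ * s * N) = ENNReal.ofReal s * ENNReal.ofReal (τ * N) := by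
      rw [← ENNReal.ofReal_mul hspos.le]; congr 1; ring
    rw [h5] at h4
    have h6 : ((N : ℝ≥0∞) - n₀) ≤ ENNReal.ofReal (τ * N) := by
      have hs0 : ENNReal.ofReal s ≠ 0 := (ENNReal.ofReal_pos.2 hspos).ne'
      exact (ENNReal.mul_le_mul_iff_right hs0 ENNReal.ofReal_ne_top).1 h4
    exact level_of_depletion_le hτ.le h6

/-- `GermRemoval → NudgeRemoval` (through s1's `nudgeRemoval_of_flatModeCondensation`). -/
theorem nudgeRemoval_of_germRemoval (h : GermRemoval) : NudgeRemoval :=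
  nudgeRemoval_of_flatModeCondensation (flatModeCondensation_of_germRemoval h)

theorem nudgeRemoval_iff_germRemoval : NudgeRemoval ↔ GermRemoval :=
  ⟨germRemoval_of_nudgeRemoval, nudgeRemoval_of_germRemoval⟩

/-- The three equivalent readings, packaged (s1 + r1). -/
theorem nudgeRemoval_iff_flatModeCondensation : NudgeRemoval ↔ FlatModeCondensation :=
  ⟨flatModeCondensation_of_nudgeRemoval, nudgeRemoval_of_flatModeCondensation⟩

/-! ## What stands between the crux and the sub-problem -/

/-- **Summit from the crux** modulo the route's three finite-`N` items: the route's `closes` with the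
proved items `NudgedCondensation_of`, `GroundStateEnergyFinite_holds`, `ScatteringLengthFinite_holds`
plugged in. -/
theorem summit_of_crux (h : NudgeRemoval) (hR : GroundStateRigidity) (hW : WalkToBEC)
    (hF : FreeDirichletBEC) : _root_.BoseEinsteinCondensation :=
  closes h NudgedCondensation_of hR hW hF GroundStateEnergyFinite_holds ScatteringLengthFinite_holds

/-- The same with the germ reading as input. -/
theorem summit_of_germ (h : GermRemoval) (hR : GroundStateRigidity) (hW : WalkToBEC)
    (hF : FreeDirichletBEC) : _root_.BoseEinsteinCondensation :=
  summit_of_crux (nudgeRemoval_of_germRemoval h) hR hW hF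

end Summit.AtomisticToContinuum.BoseEinsteinCondensation.Cruxes.NudgeRemoval.StrategistR1

end
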